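import Literature.Barriers.CriticalPhenomena.SupercriticalSAWSpaceFillingStepsNarrow
import HarnessLib

/-!
# Barrier mechanism, fifteenth audit: the blocked near-critical WINDOW made explicit —
# every fugacity window `w(δ) ≥ δ^θ`, `θ < 1/6`, is obstructed (quantitative Proposition 3)

Barrier catalogue `Literature/Barriers/CriticalPhenomena/` (D-0021); companion of
`SupercriticalSAWSpaceFillingProofs` (fifteenth audit, 2026-08-16, refuter, "barrier-audit"
gen 15, of the mechanism file `…Proofs` of `SupercriticalSAWSpaceFilling` = Theorem 1 of
H. Duminil-Copin, G. Kozma, A. Yadin, *Supercritical self-avoiding walks are space-filling*,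
Ann. IHP Probab. Stat. 50 (2014) 315–326, arXiv:1110.3074 — PROVED in the tree,
`SupercriticalSAWSpaceFilling_holds`; `blocks:` line unconditional,
`SupercriticalSAW.not_robustSAWScalingLimit`).

## What the audit found

Page-level re-reading confirms the mechanism file (§1 p. 2: "for any open set `U ⊂ Ω`,
`P_{(Ω_δ,a_δ,b_δ,x)}[γ_δ ∩ U = ∅] → 0`"; Theorem 1 p. 2; Problem 10 and Conjecture 11 p. 8 — the
latter for the hexagonal lattice, "with parameter 8/3 if `x = 1/μ`, with parameter 8 if
`x > 1/μ`"), and a forward-citation / zbMATH / arXiv sweep (27 citing works; newest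
arXiv:2310.17299, quantitative sub-ballisticity on the hexagonal lattice AT `x_c`) finds nothing
evading it. The one axis the fourteen previous audits left formally undecided is the RATE of the
blocked shrinking window: `…Narrow` proves that SOME window `w₀(δ) → 0⁺` is blocked
(`exists_window_tendsto_zero_not_windowRobust`, a diagonal argument, inexplicit) and that windows
`o(δ²)` are equivalent to the sub-problem; `…StepsNarrow` reduces the question to the growth of the
least certified box scale `m*(x) = min {m : x^{18} Z_m(x) ≥ 1600}` as `x ↓ x_c` and estimates
"about `1/6`" in prose. This file PROVES it:

* `exists_certifiedScale_le` — **quantitative Proposition 3**: there is `C` with, for every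
  `0 < η ≤ 1`, a box scale `m ≤ C/η²` such that `(x_c+η)^{18} Z_m(x_c+η) ≥ 1600`. The printed
  proof made explicit: Lemma 5 (`aₙ ≥ μⁿ e^{-c√n}`, `n` even — proved in the tree from the
  Hammersley–Welsh bound, `DKY2014_lem5_holds`) at `n = 2⌈K²/η²⌉`, `K = 2(c⁺ + 40)`, the pigeonholed
  span `m ≤ n` (`span_le_of_mem_squaredWalksOfSpan`: a coordinate changes by at most the number of
  steps), `log((x_c+η)μ) ≥ η/2` (`μ ≥ 2`), `(2n+1)² ≤ e^{8√n}` and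
  `x^{18} Z_m(x) ≥ x^{22} (xⁿ μⁿ e^{-c√n}/(2n+1)²)⁴ ≥ 3^{-22} e^{2560} ≥ 1600`. The source remarks that
  the MAXIMISING span is out of reach ("probably no easier than the SLE_{8/3} conjecture. But we
  do not need to know its value", p. 5); the trivial bound `m ≤ n` is what makes the rate poor.
* `rateConst_ge`, `prefConst_le`, `meshThreshold_ge`, `xiP_four_real` — the constants of the
  effective Theorem 6 of `…StepsNarrow` as functions of the scale: rate `≥ (1600(m+15)²)⁻¹`,
  prefactor `≤ e^{200(m+15)}` (for `1/3 ≤ x ≤ 1`; the energy `max(1,x⁻¹)^{80m+633}` of one polygon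
  insertion, paid once), mesh threshold `≥ (6000(m+15)²)⁻¹` (marked points `1, -1`), tube
  `28m + 224`.
* `schedule_pointwise`, `schedule_hypotheses` — along `x(δ) = x_c + δ^θ` with the certified scales
  `M(δ) = m(δ^θ) ≤ C δ^{-2θ}`: the criterion and the mesh threshold hold eventually (`4θ < 1`), the
  tubes shrink (`2θ < 1`), and the Peierls bound at hole size `r/δ` is
  `≤ exp(2 log δ⁻¹ + 200(C+15) δ^{-2θ} - (r/(1600(C+15)²)) δ^{4θ-1}) → 0` iff `6θ < 1`
  (`tendsto_exp_log_add_rpow_sub_rpow`: `s² e^{A s^q - a s^p} → 0` for `0 < q < p`, `a > 0`).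
* `isSpaceFillingLaws_rpow_schedule`, `not_sawScalingLimitAlong_rpow` — for `0 < θ < 1/6` the
  schedule `x_c + δ^θ` is weakly space-filling in `(𝔻; 1, -1)` and converges to no SLE_{8/3}
  (through `isSpaceFillingLaws_of_Zbox_schedule` / `not_sawScalingLimitAlong_of_Zbox_schedule`).
* `not_windowRobustSAWScalingLimit_of_rpow_le`, `not_windowRobustSAWScalingLimit_rpow` — **every
  window `w(δ) ≥ δ^θ` eventually, `θ < 1/6`, is blocked**; the closed `Prop`
  `SupercriticalSAWSpaceFillingWindowRate` with `…_holds` (axioms `propext`, `Classical.choice`,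
  `Quot.sound`).

So the catalogue's window clause now reads: blocked for `w(δ) ≥ δ^θ`, `θ < 1/6` (theorem);
equivalent to the sub-problem for `0 ≤ w(δ) = o(δ²)` (theorem); undecided in between, the
conjectural crossover being `δ^{4/3}` [LSW04, Prediction 2]. Outcome: **CONFIRMED and
STRENGTHENED on the window-rate axis**; no evasion found.

## References

* H. Duminil-Copin, G. Kozma, A. Yadin, Ann. IHP Probab. Stat. 50 (2014) 315–326,
  arXiv:1110.3074: p. 2 (§1, the weak sense of space-filling; Theorem 1), p. 4 (eq. (2.1),
  Lemma 5, Proposition 3), p. 5 (proof of Proposition 3; the maximising span is inexplicit),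
  p. 6 (Theorem 6, Proposition 7), p. 8 (Problems 9–10, Conjecture 11). [DuminilCopinKozmaYadin2014]
* G. F. Lawler, O. Schramm, W. Werner, *On the scaling limit of planar self-avoiding walk*, Proc.
  Sympos. Pure Math. 72 (2004), Prediction 2 (`ν = 3/4`). [LawlerSchrammWerner2004SAW]
* D. Krachun, C. Panagiotis, *Quantitative sub-ballisticity of self-avoiding walk on the hexagonal
  lattice*, arXiv:2310.17299 (Ann. Probab., to appear 2026), Theorem 1 (at `x_c`; cited as the
  newest forward citation, not used).

Mathlib: `Real.one_sub_inv_le_log_of_pos`, `Real.quadratic_le_exp_of_nonneg`, `Real.add_one_le_exp`,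
`Real.log_le_rpow_div`, `tendsto_rpow_atTop`, `tendsto_rpow_neg_atTop`, `tendsto_inv_nhdsGT_zero`,
`Real.tendsto_exp_atBot`, `Real.continuousAt_rpow_const`, `Real.rpow_le_rpow_of_exponent_ge`,
`Nat.le_ceil`, `Nat.ceil_lt_add_one`.
-/

noncomputable section

open MeasureTheory Filter Topology Metric Literature.Probability.LatticeModels
  Literature.Probability.Percolation Literature.Probability.RandomPlanarGeometry
  Literature.Probability.RandomPlanarGeometry.SAW
open scoped ENNReal NNReal

namespace Literature.Barriers.CriticalPhenomena

namespace SupercriticalSAW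

/-! ### The span of a squared walk is at most its length -/

/-- Along a walk of `ℤ²` every coordinate changes by at most the number of steps. [folklore] -/
theorem abs_sub_apply_le_length {u v : Site 2} (p : (zdGraph 2).Walk u v) (j : Fin 2) :
    |v j - u j| ≤ (p.length : ℤ) := by
  induction p with
  | nil => simp
  | @cons a b c h p ih =>
    rw [SimpleGraph.Walk.length_cons, Nat.cast_add, Nat.cast_one]
    have h1 := Zd.abs_sub_le_one_of_adj h j
    have h2 : |c j - a j| ≤ |c j - b j| + |b j - a j| := abs_sub_le _ _ _
    linarith

/-- The span of a squared walk is at most its length (`m ≤ n`; in fact `2m ≤ n`).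
[cite: DuminilCopinKozmaYadin2014, §2 (squared walks)] -/
theorem span_le_of_mem_squaredWalksOfSpan {n m : ℕ} {p : (zdGraph 2).Walk (0 : Site 2) (diag m)}
    (hp : p ∈ squaredWalksOfSpan n m) : m ≤ n := by
  have h := abs_sub_apply_le_length p 0
  rw [(mem_squaredWalksOfSpan.1 hp).1] at h
  have h' : |((m : ℤ)) - 0| ≤ (n : ℤ) := by simpa [diag] using h
  rw [sub_zero, Nat.abs_cast] at h'
  exact_mod_cast h'

/-! ### Quantitative Proposition 3: a certified box scale `m ≤ C/η²` at fugacity `x_c + η` -/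

/-- `3 ≤ e²`. [folklore] -/
theorem three_le_exp_two : (3 : ℝ) ≤ Real.exp 2 := by
  have := Real.add_one_le_exp (2 : ℝ); linarith

/-- `2n + 1 ≤ e^{4√n}`. [folklore] -/
theorem two_mul_add_one_le_exp_sqrt (n : ℕ) : 2 * (n : ℝ) + 1 ≤ Real.exp (4 * Real.sqrt n) := by
  have hs : 0 ≤ Real.sqrt n := Real.sqrt_nonneg _
  have h1 := Real.quadratic_le_exp_of_nonneg (by positivity : 0 ≤ 4 * Real.sqrt (n : ℝ))
  have h2 : Real.sqrt (n : ℝ) ^ 2 = n := Real.sq_sqrt (Nat.cast_nonneg _)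
  nlinarith

/-- **Quantitative Proposition 3 of Duminil-Copin–Kozma–Yadin.** There is a constant `C` such
that for every `0 < η ≤ 1` some box scale `m ≤ C/η²` satisfies the box-polygon criterion
`(x_c+η)^{18} Z_m(x_c+η) ≥ 1600` of the effective Theorem 6 (`…StepsNarrow`). Proof: the printed
proof of Proposition 3 made explicit — Lemma 5 (`aₙ ≥ μⁿe^{-c√n}`, proved in the tree,
`DKY2014_lem5_holds`) at the even length `n = 2⌈K²/η²⌉`, `K = 2(c⁺ + 40)`, the pigeonholed span
`m ≤ n` (`span_le_of_mem_squaredWalksOfSpan`), `log(xμ) ≥ η/2` and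
`Z_m(x) ≥ (x^{n+1} μⁿ e^{-c√n}/(2n+1)²)⁴`. The source: "finding the maximal `m` as an explicit
function of `n`, even asymptotically, seems difficult … But we do not need to know its value"
(p. 5). [cite: DuminilCopinKozmaYadin2014, Proposition 3 and Lemma 5] -/
theorem exists_certifiedScale_le :
    ∃ C : ℝ, 0 < C ∧ ∀ η : ℝ, 0 < η → η ≤ 1 →
      ∃ m : ℕ, (m : ℝ) ≤ C / η ^ 2 ∧
        1600 ≤ (criticalFugacity + η) ^ 18 * Zbox m (criticalFugacity + η) := by
  obtain ⟨c, hc⟩ := DKY2014_lem5_holds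
  set c' : ℝ := max c 0 with hc'
  have hc'0 : 0 ≤ c' := le_max_right _ _
  have hμ2 := two_le_connectiveConstant
  have hμ3 := connectiveConstant_le_three
  have hμ : 0 < connectiveConstant := by linarith
  -- Lemma 5 with the non-negative constant `c'`
  have h5 : ∀ n : ℕ, Even n →
      connectiveConstant ^ n * Real.exp (-(c' * Real.sqrt n)) ≤ squaredWalkCount n := by
    intro n hn
    refine le_trans (mul_le_mul_of_nonneg_left ?_ (pow_nonneg hμ.le _)) (hc n hn)
    rw [Real.exp_le_exp]
    have := Real.sqrt_nonneg (n : ℝ)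
    nlinarith [le_max_left c 0]
  set K : ℝ := 2 * (c' + 40) with hK
  have hKpos : 0 < K := by rw [hK]; linarith
  have hK80 : 80 ≤ K := by rw [hK]; linarith
  refine ⟨4 * K ^ 2, by positivity, fun η hη hη1 => ?_⟩
  have hxc3 := one_third_le_criticalFugacity
  have hxch := criticalFugacity_le_half
  set x : ℝ := criticalFugacity + η with hx
  have hx3 : 1 / 3 ≤ x := by linarith
  have hx0 : 0 < x := by linarith
  -- `ρ = xμ ≥ 1 + 2η` and `log ρ ≥ η/2`
  set ρ : ℝ := x * connectiveConstant with hρ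
  have hρ1 : 1 + 2 * η ≤ ρ := by
    have e1 : criticalFugacity * connectiveConstant = 1 := by
      rw [criticalFugacity, inv_mul_cancel₀ hμ.ne']
    have e2 : ρ = 1 + η * connectiveConstant := by rw [hρ, hx, add_mul, e1]
    rw [e2]; nlinarith
  have hρ0 : 0 < ρ := by linarith
  have hlogρ : η / 2 ≤ Real.log ρ := by
    have h1 := Real.one_sub_inv_le_log_of_pos hρ0
    have h2 : ρ⁻¹ ≤ (1 + 2 * η)⁻¹ := inv_anti₀ (by linarith) hρ1
    have h3 : (1 + 2 * η)⁻¹ = 1 - 2 * η / (1 + 2 * η) := by field_simp; ring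
    have h4 : η / 2 ≤ 2 * η / (1 + 2 * η) := by
      rw [div_le_div_iff₀ (by norm_num) (by linarith)]; nlinarith
    linarith
  -- the length `n = 2⌈K²/η²⌉`
  set N₀ : ℕ := ⌈K ^ 2 / η ^ 2⌉₊ with hN₀
  set n : ℕ := 2 * N₀ with hn
  have hn_even : Even n := ⟨N₀, by omega⟩
  have hnR : (n : ℝ) = 2 * (N₀ : ℝ) := by rw [hn]; push_cast; ring
  have hN₀ge : K ^ 2 / η ^ 2 ≤ N₀ := Nat.le_ceil _
  have hN₀0 : (0 : ℝ) ≤ N₀ := Nat.cast_nonneg _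
  have hn_ge : K ^ 2 / η ^ 2 ≤ n := by rw [hnR]; linarith
  have hK2 : 1 ≤ K ^ 2 / η ^ 2 := by
    rw [le_div_iff₀ (by positivity)]; nlinarith
  have hn_le : (n : ℝ) ≤ 4 * K ^ 2 / η ^ 2 := by
    have h1 : (N₀ : ℝ) < K ^ 2 / η ^ 2 + 1 := Nat.ceil_lt_add_one (by positivity)
    have e4 : 4 * K ^ 2 / η ^ 2 = 4 * (K ^ 2 / η ^ 2) := by ring
    rw [hnR, e4]; linarith
  have hsqrt : K / η ≤ Real.sqrt n := by
    rw [Real.le_sqrt (by positivity) (Nat.cast_nonneg _), div_pow]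
    exact hn_ge
  have hKη : K ≤ K / η := by
    rw [le_div_iff₀ hη]; nlinarith
  have hsqrt80 : 80 ≤ Real.sqrt n := by linarith
  have hs0 : 0 ≤ Real.sqrt n := Real.sqrt_nonneg _
  -- the main estimate: `Q = ρⁿ e^{-c'√n}/(2n+1)² ≥ e^{32√n}`
  set Q : ℝ := ρ ^ n * Real.exp (-(c' * Real.sqrt n)) / (2 * n + 1) ^ 2 with hQ
  have hden : 0 < (2 * (n : ℝ) + 1) ^ 2 := by positivity
  have hρn : Real.exp (n * (η / 2)) ≤ ρ ^ n := by
    have e : ρ ^ n = Real.exp (n * Real.log ρ) := by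
      rw [Real.exp_nat_mul, Real.exp_log hρ0]
    rw [e, Real.exp_le_exp]
    exact mul_le_mul_of_nonneg_left hlogρ (Nat.cast_nonneg _)
  have hden_le : (2 * (n : ℝ) + 1) ^ 2 ≤ Real.exp (8 * Real.sqrt n) := by
    have h1 := two_mul_add_one_le_exp_sqrt n
    calc (2 * (n : ℝ) + 1) ^ 2 ≤ Real.exp (4 * Real.sqrt n) ^ 2 :=
          pow_le_pow_left₀ (by positivity) h1 2
      _ = Real.exp (8 * Real.sqrt n) := by rw [← Real.exp_nat_mul]; ring_nf
  have hexp_key : (c' + 40) * Real.sqrt n ≤ n * (η / 2) := by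
    -- `n η/2 = √n · (√n η/2) ≥ √n · K/2 = √n (c'+40)`
    have h1 : K ≤ Real.sqrt n * η := by
      have := mul_le_mul_of_nonneg_right hsqrt hη.le
      rwa [div_mul_cancel₀ _ hη.ne'] at this
    have e : (n : ℝ) * (η / 2) = Real.sqrt n * (Real.sqrt n * η) / 2 := by
      rw [← mul_assoc, Real.mul_self_sqrt (Nat.cast_nonneg _)]; ring
    have e2 : (c' + 40) * Real.sqrt n = Real.sqrt n * K / 2 := by rw [hK]; ring
    have h2 : Real.sqrt n * K ≤ Real.sqrt n * (Real.sqrt n * η) := mul_le_mul_of_nonneg_left h1 hs0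
    rw [e, e2]
    linarith
  have hQ_ge : Real.exp (32 * Real.sqrt n) ≤ Q := by
    rw [hQ, le_div_iff₀ hden]
    calc Real.exp (32 * Real.sqrt n) * (2 * (n : ℝ) + 1) ^ 2
        ≤ Real.exp (32 * Real.sqrt n) * Real.exp (8 * Real.sqrt n) :=
          mul_le_mul_of_nonneg_left hden_le (Real.exp_nonneg _)
      _ = Real.exp (40 * Real.sqrt n) := by rw [← Real.exp_add]; congr 1; ring
      _ ≤ Real.exp (n * (η / 2) + -(c' * Real.sqrt n)) := by
          rw [Real.exp_le_exp]; linarith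
      _ = Real.exp (n * (η / 2)) * Real.exp (-(c' * Real.sqrt n)) := Real.exp_add _ _
      _ ≤ ρ ^ n * Real.exp (-(c' * Real.sqrt n)) :=
          mul_le_mul_of_nonneg_right hρn (Real.exp_nonneg _)
  have hQ1 : Real.exp 2560 ≤ Q := by
    refine le_trans ?_ hQ_ge
    rw [Real.exp_le_exp]; linarith
  have hQone : 1 ≤ Q := le_trans (by have := Real.add_one_le_exp (2560 : ℝ); linarith) hQ1
  -- Lemma 5 at `n`, the pigeonholed span `m`
  have h5n := h5 n hn_even
  have hPpos : 0 < connectiveConstant ^ n * Real.exp (-(c' * Real.sqrt n)) := by positivity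
  have hapos : (0 : ℝ) < squaredWalkCount n := lt_of_lt_of_le hPpos h5n
  obtain ⟨m, hm, hne⟩ := exists_span_squaredWalkCount_le n
  obtain ⟨p, hp⟩ := hne (by exact_mod_cast hapos)
  have hmn : m ≤ n := span_le_of_mem_squaredWalksOfSpan hp
  refine ⟨m, ?_, ?_⟩
  · calc (m : ℝ) ≤ n := by exact_mod_cast hmn
      _ ≤ 4 * K ^ 2 / η ^ 2 := hn_le
  · -- `P = μⁿ e^{-c'√n}/(2n+1)² ≤ #S`, `Q = xⁿ P`, `x^{18} Z_m(x) ≥ x^{22} Q⁴ ≥ 3^{-22} e^{2560} ≥ 1600`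
    set S := squaredWalksOfSpan n m with hS
    set P : ℝ := connectiveConstant ^ n * Real.exp (-(c' * Real.sqrt n)) / (2 * n + 1) ^ 2 with hP
    have hP0 : 0 ≤ P := by positivity
    have hPS : P ≤ (S.card : ℝ) := by
      rw [hP, div_le_iff₀ hden]
      have : (squaredWalkCount n : ℝ) ≤ (2 * n + 1) ^ 2 * (S.card : ℝ) := by exact_mod_cast hm
      linarith
    have hQP : Q = x ^ n * P := by
      rw [hQ, hP, hρ, mul_pow]; ring
    have hZ := pow_four_mul_pow_le_Zbox n m hx0.le
    have hx18 : (0 : ℝ) ≤ x ^ 18 := by positivity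
    have step1 : x ^ 18 * (P ^ 4 * x ^ (4 * n + 4)) ≤ x ^ 18 * Zbox m x := by
      refine mul_le_mul_of_nonneg_left (le_trans ?_ hZ) hx18
      exact mul_le_mul_of_nonneg_right (pow_le_pow_left₀ hP0 hPS 4) (by positivity)
    have step2 : x ^ 18 * (P ^ 4 * x ^ (4 * n + 4)) = x ^ 22 * Q ^ 4 := by
      rw [hQP]; ring
    have hx22 : (1 / 3 : ℝ) ^ 22 ≤ x ^ 22 := pow_le_pow_left₀ (by norm_num) hx3 22
    have hQ4 : Real.exp 2560 ≤ Q ^ 4 := hQ1.trans (le_self_pow₀ hQone (by norm_num))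
    have h329 : (3 : ℝ) ^ 29 ≤ Real.exp 2560 := by
      calc (3 : ℝ) ^ 29 ≤ Real.exp 2 ^ 29 := pow_le_pow_left₀ (by norm_num) three_le_exp_two 29
        _ = Real.exp 58 := by rw [← Real.exp_nat_mul]; norm_num
        _ ≤ Real.exp 2560 := by rw [Real.exp_le_exp]; norm_num
    have key : (1600 : ℝ) ≤ (1 / 3 : ℝ) ^ 22 * Real.exp 2560 := by
      have : (1600 : ℝ) * 3 ^ 22 ≤ 3 ^ 29 := by norm_num
      have h3 : (0 : ℝ) < 3 ^ 22 := by positivity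
      rw [show (1 / 3 : ℝ) ^ 22 = (3 ^ 22)⁻¹ by rw [one_div, inv_pow], ← div_eq_inv_mul,
        le_div_iff₀ h3]
      linarith
    calc (1600 : ℝ) ≤ (1 / 3 : ℝ) ^ 22 * Real.exp 2560 := key
      _ ≤ x ^ 22 * Q ^ 4 := mul_le_mul hx22 hQ4 (Real.exp_nonneg _) (by positivity)
      _ = x ^ 18 * (P ^ 4 * x ^ (4 * n + 4)) := step2.symm
      _ ≤ x ^ 18 * Zbox m x := step1


/-! ### Growth of the constants of the effective Theorem 6 in the box scale `m` -/

/-- **The rate of the effective Theorem 6 decays at most like `m⁻²`**: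
`rateConst m x ≥ 1/(1600 (m+15)²)` once `x^{18} Z_m(x) ≥ 1600`
(`rateConst = min(log 64/(20m+161)², log(x^{18}Z_m(x))/(400(2m+11)²))`).
[cite: DuminilCopinKozmaYadin2014, Theorem 6 (c(x))] -/
theorem rateConst_ge {x : ℝ} {m : ℕ} (hm : 1600 ≤ x ^ 18 * Zbox m x) :
    1 / (1600 * ((m : ℝ) + 15) ^ 2) ≤ rateConst m x := by
  have hC3 : ((C3P m 4 : ℕ) : ℝ) = (20 * (m : ℝ) + 161) ^ 2 := by rw [C3P_four]; push_cast; ring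
  have hL : ((OddTile.side m 4 : ℕ) : ℝ) = 2 * (m : ℝ) + 11 := by rw [side_four]; push_cast; ring
  have hm0 : (0 : ℝ) ≤ m := Nat.cast_nonneg _
  have hlog : ∀ {y : ℝ}, 3 ≤ y → 1 ≤ Real.log y := fun hy => by
    rw [Real.le_log_iff_exp_le (by linarith)]
    have := Real.exp_one_lt_d9
    linarith
  have hlog64 : 1 ≤ Real.log 64 := hlog (by norm_num)
  have hlogY : 1 ≤ Real.log (x ^ 18 * Zbox m x) := hlog (by linarith)
  have hsq : (0 : ℝ) < ((m : ℝ) + 15) ^ 2 := by positivity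
  unfold rateConst
  rw [hC3, hL]
  refine le_min ?_ ?_
  · rw [div_le_div_iff₀ (by positivity) (by positivity), one_mul]
    have h1 : (20 * (m : ℝ) + 161) ^ 2 ≤ 1600 * ((m : ℝ) + 15) ^ 2 := by nlinarith
    have h2 : 1600 * ((m : ℝ) + 15) ^ 2 ≤ Real.log 64 * (1600 * ((m : ℝ) + 15) ^ 2) :=
      le_mul_of_one_le_left (by positivity) hlog64
    linarith
  · rw [div_div, div_le_div_iff₀ (by positivity) (by positivity), one_mul]
    have h1 : 16 * (2 * (m : ℝ) + 11) ^ 2 * 25 ≤ 1600 * ((m : ℝ) + 15) ^ 2 := by nlinarith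
    have h2 : 1600 * ((m : ℝ) + 15) ^ 2 ≤ Real.log (x ^ 18 * Zbox m x) * (1600 * ((m : ℝ) + 15) ^ 2) :=
      le_mul_of_one_le_left (by positivity) hlogY
    linarith

/-- For `1/3 ≤ x ≤ 1` the criterion gives `Z_m(x) ≥ 1600` and `max(1, x⁻¹) ≤ 3`. [folklore] -/
theorem Zbox_ge_of_criterion {x : ℝ} {m : ℕ} (hx3 : 1 / 3 ≤ x) (hx1 : x ≤ 1)
    (hm : 1600 ≤ x ^ 18 * Zbox m x) : 1600 ≤ Zbox m x ∧ max 1 x⁻¹ ≤ 3 := by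
  have hx0 : 0 < x := by linarith
  refine ⟨?_, max_le (by norm_num) ?_⟩
  · have h1 : x ^ 18 ≤ 1 := pow_le_one₀ hx0.le hx1
    have h0 : 0 ≤ Zbox m x := Zbox_nonneg m hx0.le
    nlinarith
  · rw [inv_le_comm₀ hx0 (by norm_num)]
    linarith

/-- Real-variable core of the prefactor bound: with `Z ≥ 1600`, `1 ≤ q ≤ 3`, `m ≥ 0`,
`12800 (2m+11) (80 (8m+64) q^k / Z) + max(16000/Z, 0) ≤ 1280 (2m+11)(8m+64) 3^k`. [folklore] -/
theorem prefConst_core {Z q m : ℝ} {k : ℕ} (hZ : 1600 ≤ Z) (hq1 : 1 ≤ q) (hq3 : q ≤ 3) (hm0 : 0 ≤ m) :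
    25 * (4 * ((2 * m + 11) * (2 * (80 * (8 * m + 63 + 1) * q ^ k / Z) * 64))) + max (16000 / Z) 0 ≤
      1280 * ((2 * m + 11) * (8 * m + 64) * 3 ^ k) := by
  have hZ0 : 0 < Z := by linarith
  have hu0 : 0 ≤ 2 * m + 11 := by positivity
  have hv0 : 0 ≤ 8 * m + 64 := by positivity
  have hw1 : (1 : ℝ) ≤ 3 ^ k := one_le_pow₀ (by norm_num)
  have hw0 : (0 : ℝ) ≤ 3 ^ k := zero_le_one.trans hw1
  have hqk : q ^ k ≤ (3 : ℝ) ^ k := pow_le_pow_left₀ (by linarith) hq3 _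
  have hqk0 : 0 ≤ q ^ k := pow_nonneg (by linarith) _
  -- `80 (8m+64) q^k / Z ≤ (8m+64) 3^k / 20`
  have hC7 : 80 * (8 * m + 63 + 1) * q ^ k / Z ≤ (8 * m + 64) * 3 ^ k / 20 := by
    rw [div_le_div_iff₀ hZ0 (by norm_num)]
    calc 80 * (8 * m + 63 + 1) * q ^ k * 20 = 1600 * ((8 * m + 64) * q ^ k) := by ring
      _ ≤ Z * ((8 * m + 64) * 3 ^ k) :=
          mul_le_mul hZ (mul_le_mul_of_nonneg_left hqk hv0) (by positivity) hZ0.le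
      _ = (8 * m + 64) * 3 ^ k * Z := by ring
  have hC70 : 0 ≤ 80 * (8 * m + 63 + 1) * q ^ k / Z := by positivity
  have huv : (704 : ℝ) ≤ (2 * m + 11) * (8 * m + 64) := by nlinarith
  have huvw : (704 : ℝ) ≤ (2 * m + 11) * (8 * m + 64) * 3 ^ k := by
    calc (704 : ℝ) = 704 * 1 := by ring
      _ ≤ (2 * m + 11) * (8 * m + 64) * 3 ^ k := mul_le_mul huv hw1 zero_le_one (by positivity)
  have hA : 25 * (4 * ((2 * m + 11) * (2 * (80 * (8 * m + 63 + 1) * q ^ k / Z) * 64))) ≤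
      640 * ((2 * m + 11) * (8 * m + 64) * 3 ^ k) := by
    have h1 := mul_le_mul_of_nonneg_left hC7 hu0
    have e : 25 * (4 * ((2 * m + 11) * (2 * (80 * (8 * m + 63 + 1) * q ^ k / Z) * 64))) =
        12800 * ((2 * m + 11) * (80 * (8 * m + 63 + 1) * q ^ k / Z)) := by ring
    have e2 : 640 * ((2 * m + 11) * (8 * m + 64) * 3 ^ k) =
        12800 * ((2 * m + 11) * ((8 * m + 64) * 3 ^ k / 20)) := by ring
    rw [e, e2]
    exact mul_le_mul_of_nonneg_left h1 (by norm_num)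
  have hB : max (16000 / Z) 0 ≤ 10 := by
    refine max_le ?_ (by norm_num)
    rw [div_le_iff₀ hZ0]; linarith
  linarith

/-- The prefactor bound with the surgery exponent `k = 10ρ + 3` kept abstract (no large numeral
powers are ever evaluated): `prefConst m x ≤ e^{1280} e^{2m+11} e^{8m+64} e^{2k}`.
[cite: DuminilCopinKozmaYadin2014, Proposition 7] -/
theorem prefConst_le_of_eq {x : ℝ} {m k : ℕ} (hk : 10 * rhoP m 4 + 3 = k) (hx3 : 1 / 3 ≤ x)
    (hx1 : x ≤ 1) (hm : 1600 ≤ x ^ 18 * Zbox m x) :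
    prefConst m x ≤ Real.exp 1280 * Real.exp (2 * (m : ℝ) + 11) * Real.exp (8 * (m : ℝ) + 64) *
      Real.exp (2 * (k : ℝ)) := by
  obtain ⟨hZ, hmax⟩ := Zbox_ge_of_criterion hx3 hx1 hm
  have hmax1 : 1 ≤ max 1 x⁻¹ := le_max_left _ _
  have hm0 : (0 : ℝ) ≤ m := Nat.cast_nonneg _
  have hρ : ((rhoP m 4 : ℕ) : ℝ) = 8 * (m : ℝ) + 63 := by rw [rhoP_four]; push_cast; ring
  have hL : ((OddTile.side m 4 : ℕ) : ℝ) = 2 * (m : ℝ) + 11 := by rw [side_four]; push_cast; ring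
  have h1 : prefConst m x ≤ 1280 * ((2 * (m : ℝ) + 11) * (8 * (m : ℝ) + 64) * 3 ^ k) := by
    unfold prefConst Amain C7
    rw [hρ, hL, hk]
    exact prefConst_core hZ hmax1 hmax hm0
  -- `1280 u v 3^k ≤ e^{1280} eᵘ eᵛ e^{2k}` (`3 ≤ e²`)
  have h3e : (3 : ℝ) ^ k ≤ Real.exp (2 * (k : ℝ)) := by
    calc (3 : ℝ) ^ k ≤ Real.exp 2 ^ k := pow_le_pow_left₀ (by norm_num) three_le_exp_two k
      _ = Real.exp (2 * (k : ℝ)) := by rw [← Real.exp_nat_mul]; ring_nf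
  refine h1.trans ?_
  have e : 1280 * ((2 * (m : ℝ) + 11) * (8 * (m : ℝ) + 64) * 3 ^ k) =
      1280 * (2 * (m : ℝ) + 11) * (8 * (m : ℝ) + 64) * 3 ^ k := by ring
  rw [e]
  have hu0 : (0 : ℝ) ≤ 2 * (m : ℝ) + 11 := by positivity
  have hv0 : (0 : ℝ) ≤ 8 * (m : ℝ) + 64 := by positivity
  have hse : ∀ t : ℝ, t ≤ Real.exp t := fun t => by
    have := Real.add_one_le_exp t; linarith
  exact mul_le_mul (mul_le_mul (mul_le_mul (hse _) (hse _) hu0 (Real.exp_nonneg _))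
    (hse _) hv0 (by positivity)) h3e (by positivity) (by positivity)

/-- **The prefactor of the effective Theorem 6 grows at most exponentially in `m`**:
`prefConst m x ≤ e^{200(m+15)}` for `1/3 ≤ x ≤ 1` with `x^{18} Z_m(x) ≥ 1600` (the energy cost
`max(1,x⁻¹)^{10ρ+3}`, `ρ = 8m + 63`, of the polygon-insertion surgery is paid once, in the
prefactor `C₇`). [cite: DuminilCopinKozmaYadin2014, Proposition 7 (C(x,m) = 4^{100m} max(x⁶, x^{-100m+4}))] -/
theorem prefConst_le {x : ℝ} {m : ℕ} (hx3 : 1 / 3 ≤ x) (hx1 : x ≤ 1)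
    (hm : 1600 ≤ x ^ 18 * Zbox m x) : prefConst m x ≤ Real.exp (200 * ((m : ℝ) + 15)) := by
  have h := prefConst_le_of_eq rfl hx3 hx1 hm
  have hkR : ((10 * rhoP m 4 + 3 : ℕ) : ℝ) = 80 * (m : ℝ) + 633 := by
    rw [rhoP_four]; push_cast; ring
  rw [hkR] at h
  refine h.trans ?_
  rw [← Real.exp_add, ← Real.exp_add, ← Real.exp_add, Real.exp_le_exp]
  have hm0 : (0 : ℝ) ≤ m := Nat.cast_nonneg _
  linarith

/-- **The mesh threshold of the effective Theorem 6 shrinks at most like `m⁻²`** (for the marked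
points `1, -1`): `meshThreshold m x 1 (-1) ≥ 1/(6000 (m+15)²)` for `1/3 ≤ x` with
`x^{18} Z_m(x) ≥ 1600` (companion of `meshThreshold_le : … ≤ (9m+75)⁻²`).
[cite: DuminilCopinKozmaYadin2014, Theorem 6] -/
theorem meshThreshold_ge {x : ℝ} {m : ℕ} (hx3 : 1 / 3 ≤ x) (hm : 1600 ≤ x ^ 18 * Zbox m x) :
    1 / (6000 * ((m : ℝ) + 15) ^ 2) ≤ meshThreshold m x 1 (-1) := by
  have hx0 : 0 < x := by linarith
  have hm0 : (0 : ℝ) ≤ m := Nat.cast_nonneg _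
  have hK : ((KP m 4 : ℕ) : ℝ) = 9 * (m : ℝ) + 75 := by rw [KP_four]; push_cast; ring
  have hL : ((OddTile.side m 4 : ℕ) : ℝ) = 2 * (m : ℝ) + 11 := by rw [side_four]; push_cast; ring
  have hRd : ((RdP m 4 : ℕ) : ℝ) = 8 * (m : ℝ) + 69 := by rw [RdP_four]; push_cast; ring
  have hlogY : 1 ≤ Real.log (x ^ 18 * Zbox m x) := by
    rw [Real.le_log_iff_exp_le (by linarith)]
    have := Real.exp_one_lt_d9
    linarith
  have hmax : max 1 x⁻¹ ≤ 3 := max_le (by norm_num) (by rw [inv_le_comm₀ hx0 (by norm_num)]; linarith)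
  have hmax0 : 0 < max 1 x⁻¹ := lt_of_lt_of_le one_pos (le_max_left _ _)
  have hℓ : Real.log (max 1 x⁻¹) ≤ 2 :=
    calc Real.log (max 1 x⁻¹) ≤ Real.log 3 := Real.log_le_log hmax0 hmax
      _ ≤ 2 := by rw [Real.log_le_iff_le_exp (by norm_num)]; exact three_le_exp_two
  have hℓ0 : 0 ≤ Real.log (max 1 x⁻¹) := Real.log_nonneg (le_max_left _ _)
  have hnorm : ‖(1 : ℂ) - (-1)‖ = 2 := by
    rw [sub_neg_eq_add, show (1 : ℂ) + 1 = 2 by norm_num, Complex.norm_ofNat]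
  have hsq : (225 : ℝ) ≤ ((m : ℝ) + 15) ^ 2 := by nlinarith
  have hpos : (0 : ℝ) < 6000 * ((m : ℝ) + 15) ^ 2 := by positivity
  unfold meshThreshold
  rw [hK, hL, hRd, hnorm]
  refine le_min (le_min ?_ ?_) (le_min ?_ (le_min ?_ ?_))
  · exact one_div_le_one_div_of_le (by norm_num) (by nlinarith)
  · exact one_div_le_one_div_of_le (by positivity) (by nlinarith)
  · rw [div_le_div_iff₀ hpos (by norm_num)]; nlinarith
  · exact one_div_le_one_div_of_le (by positivity) (by nlinarith)
  · rw [div_le_div_iff₀ hpos (by positivity), one_mul]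
    have h1 : 16 * (2 * (m : ℝ) + 11) ^ 2 * (43 * Real.log (max 1 x⁻¹) + 2) ≤
        6000 * ((m : ℝ) + 15) ^ 2 := by
      have h2 : 43 * Real.log (max 1 x⁻¹) + 2 ≤ 88 := by linarith
      have h3 : 16 * (2 * (m : ℝ) + 11) ^ 2 ≤ 64 * ((m : ℝ) + 15) ^ 2 := by nlinarith
      have h4 : (0 : ℝ) ≤ 16 * (2 * (m : ℝ) + 11) ^ 2 := by positivity
      nlinarith
    have h2 : 6000 * ((m : ℝ) + 15) ^ 2 ≤ Real.log (x ^ 18 * Zbox m x) * (6000 * ((m : ℝ) + 15) ^ 2) :=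
      le_mul_of_one_le_left hpos.le hlogY
    linarith

/-- The tube radius in closed form over `ℝ`: `ξ = 28m + 224 ≤ 28(m+15)`. [folklore] -/
theorem xiP_four_real (m : ℕ) : ((xiP m 4 : ℕ) : ℝ) = 28 * (m : ℝ) + 224 := by
  rw [xiP_four]; push_cast; ring


/-- The prefactor is non-negative once the criterion holds (`Z_m(x) > 0`). [folklore] -/
theorem prefConst_nonneg {x : ℝ} {m : ℕ} (hx : 0 < x) (hm : 1600 ≤ x ^ 18 * Zbox m x) :
    0 ≤ prefConst m x := by
  have hZ0 : 0 < Zbox m x := by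
    by_contra h
    push Not at h
    have : x ^ 18 * Zbox m x ≤ 0 := mul_nonpos_of_nonneg_of_nonpos (by positivity) h
    linarith
  clear hm
  have hq : 0 ≤ max 1 x⁻¹ := zero_le_one.trans (le_max_left _ _)
  unfold prefConst Amain C7
  positivity

/-! ### Pure analysis: `s² e^{A s^q - a s^p} → 0` for `0 < q < p`, `a > 0` -/

/-- For `a > 0` and `0 < q < p`, `exp(2 log s + A s^q - a s^p) → 0` as `s → ∞`: the exponent is
eventually `≤ -s^q` (`log s ≤ s^q/q`). [folklore] -/
theorem tendsto_exp_log_add_rpow_sub_rpow {A a q p : ℝ} (ha : 0 < a) (hq : 0 < q) (hqp : q < p) :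
    Tendsto (fun s : ℝ => Real.exp (2 * Real.log s + A * s ^ q - a * s ^ p)) atTop (𝓝 0) := by
  refine Real.tendsto_exp_atBot.comp ?_
  have h1 : Tendsto (fun s : ℝ => a * s ^ (p - q)) atTop atTop :=
    Tendsto.const_mul_atTop ha (tendsto_rpow_atTop (by linarith))
  have hev : ∀ᶠ s in atTop, 2 * Real.log s + A * s ^ q - a * s ^ p ≤ -s ^ q := by
    filter_upwards [h1.eventually_ge_atTop (2 / q + |A| + 1), eventually_ge_atTop (1 : ℝ)]
      with s hs hs1
    have hs0 : 0 < s := by linarith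
    set t : ℝ := s ^ q with ht
    have ht0 : 0 ≤ t := Real.rpow_nonneg hs0.le q
    have hlog : Real.log s ≤ t / q := Real.log_le_rpow_div hs0.le hq
    have hsp : s ^ p = t * s ^ (p - q) := by
      rw [ht, ← Real.rpow_add hs0]; congr 1; ring
    have hA : A * t ≤ |A| * t := mul_le_mul_of_nonneg_right (le_abs_self A) ht0
    have hc : t * (2 / q + |A| + 1) ≤ t * (a * s ^ (p - q)) := mul_le_mul_of_nonneg_left hs ht0
    have hlog' : 2 * Real.log s ≤ t * (2 / q) := by
      have := mul_le_mul_of_nonneg_left hlog (by norm_num : (0 : ℝ) ≤ 2)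
      calc 2 * Real.log s ≤ 2 * (t / q) := this
        _ = t * (2 / q) := by ring
    rw [hsp]
    have e : a * (t * s ^ (p - q)) = t * (a * s ^ (p - q)) := by ring
    rw [e]
    nlinarith
  refine tendsto_atBot_mono' atTop hev ?_
  exact tendsto_neg_atTop_atBot.comp (tendsto_rpow_atTop hq)

/-! ### The explicit schedule `x(δ) = x_c + δ^θ` with certified scales, `θ < 1/6` -/

section Schedule

/-- Rewriting `C/(δ^θ)²` through `s = δ⁻¹`: `(δ⁻¹)^{2θ} = ((δ^θ)²)⁻¹`. [folklore] -/
theorem inv_rpow_two_mul {δ : ℝ} (hδ : 0 < δ) (θ : ℝ) : (δ⁻¹) ^ (2 * θ) = ((δ ^ θ) ^ 2)⁻¹ := by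
  rw [Real.inv_rpow hδ.le, show (2 : ℝ) * θ = θ * 2 from mul_comm _ _, Real.rpow_mul hδ.le,
    Real.rpow_two]

/-- `(s^{2θ})² = s^{4θ}`. [folklore] -/
theorem rpow_two_mul_sq {s : ℝ} (hs : 0 ≤ s) (θ : ℝ) : (s ^ (2 * θ)) ^ 2 = s ^ (4 * θ) := by
  rw [← Real.rpow_two, ← Real.rpow_mul hs]; congr 1; ring

variable {θ C : ℝ} {mOf : ℝ → ℕ}

/-- **Pointwise estimates along the schedule.** For `0 < θ`, a certified-scale function `mOf`
(`mOf η ≤ C/η²` certified at `x_c + η`, `0 < η ≤ 1`) and a mesh `0 < δ < 1` with `δ^θ ≤ 1/2`,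
writing `s = δ⁻¹`, `x = x_c + δ^θ`, `m = mOf(δ^θ)`, `A = C + 15`: the criterion holds at `(x, m)`,
`m + 15 ≤ A s^{2θ}`, the mesh threshold is `≥ (6000 A² s^{4θ})⁻¹`, the tube satisfies
`ξ δ ≤ 28 A s^{2θ-1}`, and the Peierls bound at hole size `r/δ` is at most
`exp(2 log s + 200 A s^{2θ} - (r/(1600 A²)) s^{1-4θ})`. [cite: DuminilCopinKozmaYadin2014, Theorem 6] -/
theorem schedule_pointwise (hθ0 : 0 < θ) (hC : 0 < C)
    (hmOf : ∀ η : ℝ, 0 < η → η ≤ 1 → (mOf η : ℝ) ≤ C / η ^ 2 ∧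
      1600 ≤ (criticalFugacity + η) ^ 18 * Zbox (mOf η) (criticalFugacity + η))
    {δ : ℝ} (hδ0 : 0 < δ) (hδ1 : δ < 1) (hδθ : δ ^ θ ≤ 1 / 2) {r : ℝ} (hr : 0 ≤ r) :
    1600 ≤ (criticalFugacity + δ ^ θ) ^ 18 * Zbox (mOf (δ ^ θ)) (criticalFugacity + δ ^ θ) ∧
    (mOf (δ ^ θ) : ℝ) + 15 ≤ (C + 15) * (δ⁻¹) ^ (2 * θ) ∧
    1 / (6000 * (C + 15) ^ 2 * (δ⁻¹) ^ (4 * θ)) ≤ meshThreshold (mOf (δ ^ θ)) (criticalFugacity + δ ^ θ) 1 (-1) ∧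
    ((xiP (mOf (δ ^ θ)) 4 : ℕ) : ℝ) * δ ≤ 28 * (C + 15) * (δ⁻¹) ^ (2 * θ - 1) ∧
    prefConst (mOf (δ ^ θ)) (criticalFugacity + δ ^ θ) / δ ^ 2 *
        Real.exp (-(rateConst (mOf (δ ^ θ)) (criticalFugacity + δ ^ θ) * (r / δ))) ≤
      Real.exp (2 * Real.log δ⁻¹ + 200 * (C + 15) * (δ⁻¹) ^ (2 * θ) -
        r / (1600 * (C + 15) ^ 2) * (δ⁻¹) ^ (1 - 4 * θ)) := by
  -- names
  set η : ℝ := δ ^ θ with hη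
  set s : ℝ := δ⁻¹ with hs
  set x : ℝ := criticalFugacity + η with hx
  set m : ℕ := mOf η with hmdef
  set A : ℝ := C + 15 with hA
  have hη0 : 0 < η := Real.rpow_pos_of_pos hδ0 θ
  have hη1 : η ≤ 1 := by linarith
  obtain ⟨hmC, hcrit⟩ := hmOf η hη0 hη1
  have hxc3 := one_third_le_criticalFugacity
  have hxch := criticalFugacity_le_half
  have hx3 : 1 / 3 ≤ x := by rw [hx]; linarith
  have hx1 : x ≤ 1 := by rw [hx]; linarith
  have hx0 : 0 < x := by linarith
  have hs1 : 1 < s := by rw [hs]; exact one_lt_inv₀ hδ0 |>.2 hδ1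
  have hs0 : 0 < s := by linarith
  have hsθ1 : 1 ≤ s ^ (2 * θ) := Real.one_le_rpow hs1.le (by linarith)
  have hsθ0 : 0 < s ^ (2 * θ) := by linarith
  have hA0 : 0 < A := by rw [hA]; linarith
  -- `m + 15 ≤ A s^{2θ}`
  have hm15 : (m : ℝ) + 15 ≤ A * s ^ (2 * θ) := by
    have e : C / η ^ 2 = C * s ^ (2 * θ) := by
      rw [hs, inv_rpow_two_mul hδ0, hη, div_eq_mul_inv]
    rw [hmdef, hA, add_mul]
    have : (mOf η : ℝ) ≤ C * s ^ (2 * θ) := e ▸ hmC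
    nlinarith
  have hm0 : (0 : ℝ) ≤ (m : ℝ) := Nat.cast_nonneg _
  have hm15pos : (0 : ℝ) < (m : ℝ) + 15 := by linarith
  have hsq : ((m : ℝ) + 15) ^ 2 ≤ A ^ 2 * s ^ (4 * θ) := by
    rw [← rpow_two_mul_sq hs0.le, ← mul_pow]
    exact pow_le_pow_left₀ hm15pos.le hm15 2
  have hs4 : 0 < s ^ (4 * θ) := Real.rpow_pos_of_pos hs0 _
  refine ⟨hcrit, hm15, ?_, ?_, ?_⟩
  · -- mesh threshold
    refine le_trans ?_ (meshThreshold_ge hx3 hcrit)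
    refine one_div_le_one_div_of_le (by positivity) ?_
    calc 6000 * ((m : ℝ) + 15) ^ 2 ≤ 6000 * (A ^ 2 * s ^ (4 * θ)) :=
          mul_le_mul_of_nonneg_left hsq (by norm_num)
      _ = 6000 * A ^ 2 * s ^ (4 * θ) := by ring
  · -- tube: `(28m + 224) δ ≤ 28 (m+15) δ ≤ 28 A s^{2θ} δ = 28 A s^{2θ-1}`
    rw [xiP_four_real]
    have e : s ^ (2 * θ - 1) = s ^ (2 * θ) * δ := by
      rw [Real.rpow_sub_one hs0.ne', hs, div_eq_mul_inv, inv_inv]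
    rw [e]
    have h1 : (28 * (m : ℝ) + 224) ≤ 28 * (A * s ^ (2 * θ)) := by linarith
    have := mul_le_mul_of_nonneg_right h1 hδ0.le
    linarith
  · -- the Peierls bound at hole size `r/δ`
    have hpref := prefConst_le hx3 hx1 hcrit
    have hpref0 := prefConst_nonneg hx0 hcrit
    have hrate := rateConst_ge hcrit
    -- the rate term: `rateConst · (r/δ) ≥ (r/(1600 A²)) s^{1-4θ}`
    have hrs : r / (1600 * A ^ 2) * s ^ (1 - 4 * θ) ≤ rateConst m x * (r / δ) := by
      have e1 : s ^ (1 - 4 * θ) = s / s ^ (4 * θ) := by rw [Real.rpow_sub hs0, Real.rpow_one]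
      have e2 : r / δ = r * s := by rw [hs, div_eq_mul_inv]
      rw [e1, e2]
      have h1 : 1 / (1600 * (A ^ 2 * s ^ (4 * θ))) ≤ 1 / (1600 * ((m : ℝ) + 15) ^ 2) :=
        one_div_le_one_div_of_le (by positivity) (by nlinarith)
      have h2 : 1 / (1600 * (A ^ 2 * s ^ (4 * θ))) ≤ rateConst m x := h1.trans hrate
      have h3 := mul_le_mul_of_nonneg_right h2 (by positivity : 0 ≤ r * s)
      calc r / (1600 * A ^ 2) * (s / s ^ (4 * θ)) = 1 / (1600 * (A ^ 2 * s ^ (4 * θ))) * (r * s) := by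
            field_simp
        _ ≤ rateConst m x * (r * s) := h3
    have hexp1 : Real.exp (-(rateConst m x * (r / δ))) ≤
        Real.exp (-(r / (1600 * A ^ 2) * s ^ (1 - 4 * θ))) := by
      rw [Real.exp_le_exp]; linarith
    have hexp2 : prefConst m x ≤ Real.exp (200 * A * s ^ (2 * θ)) := by
      refine hpref.trans ?_
      rw [Real.exp_le_exp]
      have := mul_le_mul_of_nonneg_left hm15 (by norm_num : (0 : ℝ) ≤ 200)
      linarith
    have hδ2 : 1 / δ ^ 2 = Real.exp (2 * Real.log s) := by
      rw [show (2 : ℝ) * Real.log s = ((2 : ℕ) : ℝ) * Real.log s by norm_num, Real.exp_nat_mul,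
        Real.exp_log hs0, hs, inv_pow, one_div]
    have hδ20 : 0 < 1 / δ ^ 2 := by positivity
    calc prefConst m x / δ ^ 2 * Real.exp (-(rateConst m x * (r / δ)))
        = prefConst m x * (1 / δ ^ 2) * Real.exp (-(rateConst m x * (r / δ))) := by ring
      _ ≤ Real.exp (200 * A * s ^ (2 * θ)) * (1 / δ ^ 2) *
            Real.exp (-(r / (1600 * A ^ 2) * s ^ (1 - 4 * θ))) :=
          mul_le_mul (mul_le_mul_of_nonneg_right hexp2 hδ20.le) hexp1 (Real.exp_nonneg _)
            (by positivity)
      _ = Real.exp (2 * Real.log s + 200 * A * s ^ (2 * θ) - r / (1600 * A ^ 2) * s ^ (1 - 4 * θ)) := by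
          rw [hδ2, ← Real.exp_add, ← Real.exp_add]; congr 1; ring

/-- **The schedule `x(δ) = x_c + δ^θ`, `0 < θ < 1/6`, carries certified scales satisfying the
hypotheses of the effective schedule theorem** (`isSpaceFillingLaws_of_Zbox_schedule`,
`not_sawScalingLimitAlong_of_Zbox_schedule` of `…StepsNarrow`): the criterion and the mesh
threshold eventually, shrinking tubes, and a vanishing Peierls bound at every macroscopic hole
size. The exponent `1/6` is where the prefactor `e^{O(m)}`, `m ≍ δ^{-2θ}`, is beaten by the rate
`m⁻² · r/δ ≍ δ^{4θ - 1}`. [cite: DuminilCopinKozmaYadin2014, Theorem 6 and Proposition 3] -/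
theorem schedule_hypotheses (hθ0 : 0 < θ) (hθ : θ < 1 / 6) (hC : 0 < C)
    (hmOf : ∀ η : ℝ, 0 < η → η ≤ 1 → (mOf η : ℝ) ≤ C / η ^ 2 ∧
      1600 ≤ (criticalFugacity + η) ^ 18 * Zbox (mOf η) (criticalFugacity + η)) :
    (∀ᶠ δ in 𝓝[>] (0 : ℝ), 0 < criticalFugacity + δ ^ θ ∧
        1600 ≤ (criticalFugacity + δ ^ θ) ^ 18 * Zbox (mOf (δ ^ θ)) (criticalFugacity + δ ^ θ) ∧
        δ < meshThreshold (mOf (δ ^ θ)) (criticalFugacity + δ ^ θ) 1 (-1)) ∧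
    Tendsto (fun δ : ℝ => ((xiP (mOf (δ ^ θ)) 4 : ℕ) : ℝ) * δ) (𝓝[>] 0) (𝓝 0) ∧
    (∀ r : ℝ, 0 < r → Tendsto (fun δ : ℝ => prefConst (mOf (δ ^ θ)) (criticalFugacity + δ ^ θ) / δ ^ 2 *
        Real.exp (-(rateConst (mOf (δ ^ θ)) (criticalFugacity + δ ^ θ) * (r / δ)))) (𝓝[>] 0) (𝓝 0)) := by
  have hA0 : 0 < C + 15 := by linarith
  have hxc := criticalFugacity_pos_lt_one'.1
  -- the basic eventual conditions: `0 < δ < 1`, `δ^θ ≤ 1/2`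
  have hIoo : ∀ᶠ δ in 𝓝[>] (0 : ℝ), δ ∈ Set.Ioo 0 1 := Ioo_mem_nhdsGT one_pos
  have hrpow0 : Tendsto (fun δ : ℝ => δ ^ θ) (𝓝[>] 0) (𝓝 0) := by
    have hc := (Real.continuousAt_rpow_const 0 θ (Or.inr hθ0.le)).tendsto
    rw [Real.zero_rpow hθ0.ne'] at hc
    exact hc.mono_left nhdsWithin_le_nhds
  have hhalf : ∀ᶠ δ in 𝓝[>] (0 : ℝ), δ ^ θ ≤ 1 / 2 :=
    (hrpow0.eventually (Iic_mem_nhds (by norm_num : (0 : ℝ) < 1 / 2)))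
  have hinv : Tendsto (fun δ : ℝ => δ⁻¹) (𝓝[>] 0) atTop := tendsto_inv_nhdsGT_zero
  refine ⟨?_, ?_, fun r hr => ?_⟩
  · -- criterion and mesh threshold: need `6000 A² < s^{1-4θ}` eventually
    have hbig : ∀ᶠ δ in 𝓝[>] (0 : ℝ), 6000 * (C + 15) ^ 2 + 1 ≤ (δ⁻¹) ^ (1 - 4 * θ) :=
      hinv.eventually ((tendsto_rpow_atTop (by linarith)).eventually_ge_atTop _)
    filter_upwards [hIoo, hhalf, hbig] with δ hδ hδθ hδbig
    obtain ⟨hcrit, -, hmesh, -, -⟩ := schedule_pointwise hθ0 hC hmOf hδ.1 hδ.2 hδθ le_rfl (r := 0)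
    refine ⟨by have := Real.rpow_pos_of_pos hδ.1 θ; linarith, hcrit, lt_of_lt_of_le ?_ hmesh⟩
    -- `δ = 1/s < 1/(6000 A² s^{4θ})` iff `6000 A² s^{4θ} < s = s^{4θ} s^{1-4θ}`
    have hs0 : 0 < δ⁻¹ := inv_pos.2 hδ.1
    have hs4 : 0 < (δ⁻¹) ^ (4 * θ) := Real.rpow_pos_of_pos hs0 _
    have e2 : (δ⁻¹) ^ (4 * θ) * (δ⁻¹) ^ (1 - 4 * θ) = δ⁻¹ := by
      rw [← Real.rpow_add hs0, show 4 * θ + (1 - 4 * θ) = (1 : ℝ) by ring, Real.rpow_one]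
    have key : 6000 * (C + 15) ^ 2 * (δ⁻¹) ^ (4 * θ) < δ⁻¹ := by
      calc 6000 * (C + 15) ^ 2 * (δ⁻¹) ^ (4 * θ) = (δ⁻¹) ^ (4 * θ) * (6000 * (C + 15) ^ 2) := by ring
        _ < (δ⁻¹) ^ (4 * θ) * (δ⁻¹) ^ (1 - 4 * θ) := mul_lt_mul_of_pos_left (by linarith) hs4
        _ = δ⁻¹ := e2
    calc δ = 1 / δ⁻¹ := by rw [one_div, inv_inv]
      _ < 1 / (6000 * (C + 15) ^ 2 * (δ⁻¹) ^ (4 * θ)) := one_div_lt_one_div_of_lt (by positivity) key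
  · -- tubes: `0 ≤ ξ δ ≤ 28 A s^{2θ - 1} → 0`
    have hup : Tendsto (fun δ : ℝ => 28 * (C + 15) * (δ⁻¹) ^ (2 * θ - 1)) (𝓝[>] 0) (𝓝 0) := by
      have h1 := (tendsto_rpow_neg_atTop (by linarith : 0 < 1 - 2 * θ)).comp hinv
      have h2 := h1.const_mul (28 * (C + 15))
      rw [mul_zero] at h2
      refine h2.congr' (Eventually.of_forall fun δ => ?_)
      show 28 * (C + 15) * (δ⁻¹) ^ (-(1 - 2 * θ)) = 28 * (C + 15) * (δ⁻¹) ^ (2 * θ - 1)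
      rw [neg_sub]
    refine tendsto_of_tendsto_of_tendsto_of_le_of_le' tendsto_const_nhds hup ?_ ?_
    · filter_upwards [hIoo] with δ hδ
      exact mul_nonneg (Nat.cast_nonneg _) hδ.1.le
    · filter_upwards [hIoo, hhalf] with δ hδ hδθ
      exact (schedule_pointwise hθ0 hC hmOf hδ.1 hδ.2 hδθ le_rfl (r := 0)).2.2.2.1
  · -- the Peierls bound: squeeze under `exp(2 log s + 200 A s^{2θ} - a s^{1-4θ}) → 0`
    have ha : 0 < r / (1600 * (C + 15) ^ 2) := by positivity
    have hup := (tendsto_exp_log_add_rpow_sub_rpow (A := 200 * (C + 15)) ha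
      (by linarith : 0 < 2 * θ) (by linarith : 2 * θ < 1 - 4 * θ)).comp hinv
    refine tendsto_of_tendsto_of_tendsto_of_le_of_le' tendsto_const_nhds hup ?_ ?_
    · filter_upwards [hIoo, hhalf] with δ hδ hδθ
      obtain ⟨hcrit, -⟩ := schedule_pointwise hθ0 hC hmOf hδ.1 hδ.2 hδθ le_rfl (r := 0)
      have hx0 : 0 < criticalFugacity + δ ^ θ := by
        have := Real.rpow_pos_of_pos hδ.1 θ; linarith
      exact mul_nonneg (div_nonneg (prefConst_nonneg hx0 hcrit) (by positivity)) (Real.exp_nonneg _)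
    · filter_upwards [hIoo, hhalf] with δ hδ hδθ
      exact (schedule_pointwise hθ0 hC hmOf hδ.1 hδ.2 hδθ hr.le).2.2.2.2

end Schedule


/-! ### Assembly: every window `w(δ) ≥ δ^θ`, `θ < 1/6`, is blocked -/

/-- A certified-scale FUNCTION `η ↦ m(η) ≤ C/η²` (choice applied to `exists_certifiedScale_le`).
[cite: DuminilCopinKozmaYadin2014, Proposition 3] -/
theorem exists_certifiedScaleFun :
    ∃ C : ℝ, 0 < C ∧ ∃ mOf : ℝ → ℕ, ∀ η : ℝ, 0 < η → η ≤ 1 →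
      (mOf η : ℝ) ≤ C / η ^ 2 ∧ 1600 ≤ (criticalFugacity + η) ^ 18 * Zbox (mOf η) (criticalFugacity + η) := by
  obtain ⟨C, hC, h⟩ := exists_certifiedScale_le
  classical
  refine ⟨C, hC, fun η => if hη : 0 < η ∧ η ≤ 1 then Classical.choose (h η hη.1 hη.2) else 0,
    fun η hη hη1 => ?_⟩
  have hc : (0 < η ∧ η ≤ 1) := ⟨hη, hη1⟩
  simp only [dif_pos hc]
  exact Classical.choose_spec (h η hη hη1)

/-- **The supercritical schedule `x(δ) = x_c + δ^θ`, `0 < θ < 1/6`, is weakly space-filling in the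
unit disc** (closest-site endpoints at `1, -1`): every open subset of `𝔻` is visited with
probability `→ 1` although `x(δ) → x_c`. [cite: DuminilCopinKozmaYadin2014, Theorem 1 and Theorem 6] -/
theorem isSpaceFillingLaws_rpow_schedule {θ : ℝ} (hθ0 : 0 < θ) (hθ : θ < 1 / 6) {A B : ℝ → Site 2}
    (hAB : ∀ δ : ℝ, 0 < δ → IsClosestSite unitDisk δ 1 (A δ) ∧ IsClosestSite unitDisk δ (-1) (B δ)) :
    IsSpaceFillingLaws unitDisk A B fun δ => lawAt (criticalFugacity + δ ^ θ) unitDisk δ (A δ) (B δ) := by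
  obtain ⟨C, hC, mOf, hmOf⟩ := exists_certifiedScaleFun
  obtain ⟨hX, hξ, hrate⟩ := schedule_hypotheses hθ0 hθ hC hmOf
  have hne : (1 : ℂ) ≠ -1 := fun h => by
    have h' := congrArg Complex.re h
    norm_num at h'
  exact isSpaceFillingLaws_of_Zbox_schedule (X := fun δ => criticalFugacity + δ ^ θ)
    (M := fun δ => mOf (δ ^ θ)) (a := 1) (b := -1) norm_one (by simp) hne hAB hX hξ hrate

/-- **No SLE_{8/3} along `x(δ) = x_c + δ^θ` for `0 < θ < 1/6`** (unconditional): the explicit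
substitute for the inexplicit diagonal schedule of `…Narrow`.
[cite: DuminilCopinKozmaYadin2014, Theorem 1] -/
theorem not_sawScalingLimitAlong_rpow {θ : ℝ} (hθ0 : 0 < θ) (hθ : θ < 1 / 6) :
    ¬ SAWScalingLimitAlong fun δ => criticalFugacity + δ ^ θ := by
  obtain ⟨C, hC, mOf, hmOf⟩ := exists_certifiedScaleFun
  obtain ⟨hX, hξ, hrate⟩ := schedule_hypotheses hθ0 hθ hC hmOf
  exact not_sawScalingLimitAlong_of_Zbox_schedule (X := fun δ => criticalFugacity + δ ^ θ)
    (M := fun δ => mOf (δ ^ θ)) hX hξ hrate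

/-- **Every fugacity window eventually as wide as `δ^θ`, `θ < 1/6`, is blocked**: the window-robust
strengthening `WindowRobustSAWScalingLimit w` of the sub-problem is false as soon as
`w(δ) ≥ δ^θ` for small `δ`. (For `θ ≤ 1/12` one compares with `δ^{1/12} ≤ δ^θ`, `δ < 1`.) This makes
the blocked shrinking window `w₀(δ) → 0` of `exists_window_tendsto_zero_not_windowRobust`
(`…Narrow`, inexplicit) explicit: `w₀(δ) = δ^θ` for any `θ < 1/6`.
[cite: DuminilCopinKozmaYadin2014, Theorem 1 and Proposition 3] -/
theorem not_windowRobustSAWScalingLimit_of_rpow_le {θ : ℝ} (hθ : θ < 1 / 6) {w : ℝ → ℝ}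
    (hw : ∀ᶠ δ in 𝓝[>] (0 : ℝ), δ ^ θ ≤ w δ) : ¬ WindowRobustSAWScalingLimit w := by
  set θ' : ℝ := max θ (1 / 12) with hθ'
  have hθ'0 : 0 < θ' := lt_of_lt_of_le (by norm_num) (le_max_right _ _)
  have hθ'6 : θ' < 1 / 6 := max_lt hθ (by norm_num)
  obtain ⟨C, hC, mOf, hmOf⟩ := exists_certifiedScaleFun
  obtain ⟨hX, hξ, hrate⟩ := schedule_hypotheses hθ'0 hθ'6 hC hmOf
  refine not_windowRobustSAWScalingLimit_of_Zbox_schedule (X := fun δ => criticalFugacity + δ ^ θ')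
    (M := fun δ => mOf (δ ^ θ')) ?_ hX hξ hrate
  have hIoo : ∀ᶠ δ in 𝓝[>] (0 : ℝ), δ ∈ Set.Ioo 0 1 := Ioo_mem_nhdsGT one_pos
  filter_upwards [hw, hIoo] with δ hwδ hδ
  have h1 : δ ^ θ' ≤ δ ^ θ := Real.rpow_le_rpow_of_exponent_ge hδ.1 hδ.2.le (le_max_left _ _)
  have h0 : 0 ≤ δ ^ θ' := Real.rpow_nonneg hδ.1.le _
  rw [add_sub_cancel_left, abs_of_nonneg h0]
  exact h1.trans hwδ

/-- In particular the polynomial windows themselves are blocked: `¬ WindowRobustSAWScalingLimit (δ ↦ δ^θ)`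
for every `θ < 1/6`. [cite: DuminilCopinKozmaYadin2014, Theorem 1] -/
theorem not_windowRobustSAWScalingLimit_rpow {θ : ℝ} (hθ : θ < 1 / 6) :
    ¬ WindowRobustSAWScalingLimit fun δ => δ ^ θ :=
  not_windowRobustSAWScalingLimit_of_rpow_le hθ (Eventually.of_forall fun _ => le_rfl)

end SupercriticalSAW

open SupercriticalSAW

/-- **Barrier `SupercriticalSAWSpaceFillingWindowRate`** (fifteenth audit of `…Proofs`, PROVED
below): the reach of Theorem 1 of Duminil-Copin–Kozma–Yadin into SHRINKING fugacity windows made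
explicit — every window-robust strengthening `SupercriticalSAW.WindowRobustSAWScalingLimit w` of
the sub-problem whose window is eventually `≥ δ^θ` for some `θ < 1/6` is false.

BARRIER (structured block, D-0021):
- technique_class: polynomially-wide near-critical fugacity windows (an SLE_{8/3} CONCLUSION asserted along every schedule `X(δ)` with `|X(δ) - x_c| ≤ w(δ)`, for a window `w(δ) ≥ δ^θ` eventually, `θ < 1/6`; contains every constant window `ε > 0` of `SupercriticalSAWSpaceFilling` / `…Narrow`, since `δ^{1/12} ≤ ε` eventually) [cite: DuminilCopinKozmaYadin2014, Theorem 1]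
- blocks: `WindowRobustSAWScalingLimit w` for every such `w` (`SupercriticalSAW.not_windowRobustSAWScalingLimit_of_rpow_le`), in particular `WindowRobustSAWScalingLimit (δ ↦ δ^θ)`, `θ < 1/6` (`SupercriticalSAW.not_windowRobustSAWScalingLimit_rpow`) and `SAWScalingLimitAlong (δ ↦ x_c + δ^θ)`, `0 < θ < 1/6` (`SupercriticalSAW.not_sawScalingLimitAlong_rpow`); positively, the schedule `x_c + δ^θ` is weakly space-filling in the disc (`SupercriticalSAW.isSpaceFillingLaws_rpow_schedule`) — all unconditional (axioms `propext`, `Classical.choice`, `Quot.sound`)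
- because: the printed proof of Proposition 3 is quantitative once the span of the squared walks is bounded by their length: Lemma 5 (`aₙ ≥ μⁿ e^{-c√n}`, from the Hammersley–Welsh bound (2.1)) at `n ≍ (c/η)²` gives a certified box scale `m ≤ C/η²` with `(x_c+η)^{18} Z_m(x_c+η) ≥ 1600` (`SupercriticalSAW.exists_certifiedScale_le`) [cite: DuminilCopinKozmaYadin2014, Lemma 5 and Proposition 3]; the effective Theorem 6 of `…StepsNarrow` then has tube `28m + 224`, mesh threshold `≥ (6000(m+15)²)⁻¹`, rate `≥ (1600(m+15)²)⁻¹` and prefactor `≤ e^{200(m+15)}` (`SupercriticalSAW.meshThreshold_ge`, `rateConst_ge`, `prefConst_le`: the energy `max(1,x⁻¹)^{10ρ+3}` of one polygon insertion [cite: DuminilCopinKozmaYadin2014, Proposition 7]), so along `η = δ^θ` the Peierls bound at a macroscopic hole is `≤ δ^{-2} exp(O(δ^{-2θ}) - Ω(δ^{4θ-1})) → 0` exactly when `6θ < 1`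
- evasions_known: windows `δ^{1/6} ≲ w(δ)` down to the sub-volume windows `o(δ²)` (which are EQUIVALENT to the sub-problem, `SupercriticalSAW.windowRobustSAWScalingLimit_iff` in `…Narrow`) are decided by no theorem; the predicted crossover is `|x - x_c| ≍ δ^{4/3}` (`ν = 3/4`) [cite: LawlerSchrammWerner2004SAW, Prediction 2], so the interval of exponents `(1/6, 4/3)` is expected to be blocked in substance but is not in the tree — improving `1/6` needs either a better span/length trade-off for squared walks (the source: "finding the maximal `m` as an explicit function of `n`, even asymptotically, seems difficult" [cite: DuminilCopinKozmaYadin2014, §2 (proof of Proposition 3)]) or a Peierls sum whose per-box gain `x^{18} Z_m(x)/25` is used in the rate instead of the cap `log 64/C₃`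
- scope_caveats: unit disc, `ℤ²`, closest-site endpoints `1, -1` (any boundary pair `a ≠ b` works with `‖a-b‖/26` in the mesh threshold), hole-size ⇒ weak space-filling ⇒ no SLE_κ (`κ ≤ 4` inputs of `…StepsNarrow`); the exponent `1/6` and all constants are artefacts of the tree's tile proof (`r = 4`, threshold `1600`), not of the source, whose `m(x)`, `ξ(x) = 6m`, `c(x)` are inexplicit [cite: DuminilCopinKozmaYadin2014, Theorem 1 and Theorem 6]
- status: established (proved in the tree: `SupercriticalSAWSpaceFillingWindowRate_holds`)

[cite: DuminilCopinKozmaYadin2014, Theorem 1 and Proposition 3] -/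
def SupercriticalSAWSpaceFillingWindowRate : Prop :=
  ∀ θ : ℝ, θ < 1 / 6 → ∀ w : ℝ → ℝ,
    (∀ᶠ δ in 𝓝[>] (0 : ℝ), δ ^ θ ≤ w δ) → ¬ SupercriticalSAW.WindowRobustSAWScalingLimit w

/-- **The window-rate barrier holds.** [cite: DuminilCopinKozmaYadin2014, Theorem 1 and Proposition 3] -/
theorem SupercriticalSAWSpaceFillingWindowRate_holds : SupercriticalSAWSpaceFillingWindowRate :=
  fun _ hθ _ hw => not_windowRobustSAWScalingLimit_of_rpow_le hθ hw

end Literature.Barriers.CriticalPhenomena
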